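import Summits.HubbardSuperconductivity.HubbardSuperconductivity.Theorems.AnisotropyChordInsertionEntropyJDiv

/-!
# Route `AnisotropyChord` / H0 rotor rung: the entropy route — the INFRARED END in the tree's currency
# (structure factor, Landau gap bound (Λ_α), infrared structure bound (IR_α), one-body insertion
# structure H1, the typed reduction `H1 ∧ IR_α ∧ S ≤ S_max ⇒ E_J`) and THEOREM E-JASTROW (proved)
# (theory seat memo ROTOR-THEORY-7 §92–§94; Sketch7 Parts E–F transplanted verbatim up to tags)

* `torusPhase`, `torusNorm`, `kernelFT`, `structureFactor`, `shiftConfig`;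
* typed hypotheses `LandauGapBound`, `InfraredStructureBound`, `StructureFactorUpper`,
  `OneBodyInsertionStructure` and the named reduction `EntropyRouteReduction` (paper-proved; Lean proof
  deferred: character orthogonality on `(ℤ/L)²`);
* **THEOREM E-JASTROW** `condensateDensity_ge_of_onebody`: an exactly one-body insertion ratio with an
  `ℓ¹` kernel forces `n₀/|V| ≥ ρ(1−ρ_M)e^{−B}` (every finite-range Jastrow family condenses, any dimension).

Typing authority: theory seat `hubbard-h0-rotor-theory-1`, cycle 7.  Nothing here claims the hypotheses.
-/

set_option linter.dupNamespace false

noncomputable section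

open Matrix Finset Real Filter Topology
open Literature.MathematicalPhysics.QuantumLattice Literature.Probability.LatticeModels

namespace Summit.HubbardSuperconductivity.HubbardSuperconductivity.Theorems.AnisotropyChord.InsertionEntropy

/-! ## E. The infrared end in the tree's currency -/

section Infrared

/-- Torus character `e^{2πi k·s/L}` on `(ℤ/L)²` (via `ZMod.val`). (theory seat `hubbard-h0-rotor-theory-1`, memo ROTOR-THEORY-7) [folklore] -/
def torusPhase (L : ℕ) [NeZero L] (k s : TorusSite 2 L) : ℂ :=
  Complex.exp (2 * Real.pi * Complex.I * ((∑ i, (k i).val * (s i).val : ℕ) : ℂ) / (L : ℂ))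

/-- Reduced wave number `|k|_T = (2π/L) · ‖k‖` with each component reduced to `[-L/2, L/2]`. (theory seat `hubbard-h0-rotor-theory-1`, memo ROTOR-THEORY-7) [folklore] -/
def torusNorm (L : ℕ) [NeZero L] (k : TorusSite 2 L) : ℝ :=
  2 * Real.pi / (L : ℝ) * Real.sqrt (∑ i, ((min (k i).val (L - (k i).val) : ℕ) : ℝ) ^ 2)

/-- Finite Fourier transform of a one-body kernel, `Û(k) = Σ_s U(s) e^{2πi k·s/L}`. (theory seat `hubbard-h0-rotor-theory-1`, memo ROTOR-THEORY-7) [folklore] -/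
def kernelFT (L : ℕ) [NeZero L] (U : TorusSite 2 L → ℝ) (k : TorusSite 2 L) : ℂ :=
  ∑ s, (U s : ℂ) * torusPhase L k s

/-- Static structure factor of a real amplitude `a` with `P` particles:
`S_a(k) = P⁻¹ Σ_σ a(σ)² |Σ_{s : σ s = 0} e^{2πi k·s/L}|²` (`= ⟨|ρ_k|²⟩/P`). [folklore] -/
def structureFactor (L : ℕ) [NeZero L] (a : TensorIndex (TorusSite 2 L) 2 → ℝ) (P : ℝ)
    (k : TorusSite 2 L) : ℝ :=
  (∑ σ, a σ ^ 2 * ‖∑ s, (if σ s = 0 then torusPhase L k s else 0)‖ ^ 2) / P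

/-- Configuration translated by `v`. (theory seat `hubbard-h0-rotor-theory-1`, memo ROTOR-THEORY-7) [folklore] -/
def shiftConfig (L : ℕ) [NeZero L] (v : TorusSite 2 L) (σ : TensorIndex (TorusSite 2 L) 2) :
    TensorIndex (TorusSite 2 L) 2 := fun s => σ (s + v)

/-- **HYPOTHESIS (Λ_α) — `LandauGapBound` (sector form of Landau's criterion, typed).**  There are
`c > 0` and `α < 2` such that, eventually in `L`, every state of the sector `M L` with lattice momentum
`k ≠ 0` has energy at least `E₀(M L) + c |k|_T^α`:  no excitation branch softer than `|k|^α`, uniformly in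
the volume.  Linear phonons give `α = 1`; the route needs only `α < 2` (memo §92).  FAILS in `d = 1` at
`k = 2πρ` (the `2k_F` soft mode, `ω₀ = 2 sin(π/L)` at the free point — ED c12/c16), which is where the
dimension enters besides the `Σ_k |k|^{-α}` count.  Whether (S)+(K) ⇒ (Λ_α) is cycle-1's
`CruxLandauVelocity`, open. [conjecture: theory seat hubbard-h0-rotor-theory-1, cycle 7, 2026-08-28 — memo ROTOR-THEORY-7 §92 hypothesis (Λ_α)] -/
def LandauGapBound (Δ : ℝ) (M : ℕ → ℝ) : Prop :=
  ∃ c > (0 : ℝ), ∃ α < (2 : ℝ), ∀ᶠ L : ℕ in atTop, ∀ [NeZero L],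
    ∀ k : TorusSite 2 L, k ≠ 0 →
      ∀ φ : TensorIndex (TorusSite 2 L) 2 → ℂ,
        φ ∈ spinZSector (Λ := TorusSite 2 L) 1 (M L) →
        (∀ v, (fun σ => φ (shiftConfig L v σ)) = torusPhase L k v • φ) →
          (lowestEnergyInSector 1 (xxzHamiltonian 1 (torusGraph 2 L) (-1) Δ) (M L)
              + c * (torusNorm L k) ^ α) * (∑ σ, ‖φ σ‖ ^ 2)
            ≤ (∑ σ, (starRingEnd ℂ) (φ σ)
                * ((xxzHamiltonian 1 (torusGraph 2 L) (-1) Δ).mulVec φ) σ).re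

/-- **HYPOTHESIS (IR_α) — `InfraredStructureBound`** (what the route actually consumes):
`S_L(k) ≥ c |k|_T^α` with `α < 2` for the reference Perron states, eventually in `L`, all `k ≠ 0`.
By LEMMA M (`zerothMoment_ge_gap_mul_invMoment`), (Λ_α) together with a LOWER compressibility bound
`χ_L(k) ≥ χ₀ > 0` implies (IR_α) with the same `α` (saturated to ≤ 1 % at `k_min` in ED, memo §92).
The uncertainty/f-sum bound alone gives only `α = 2` (borderline: `J ≲ C log L`, a power-law floor
`n₀/|Λ| ≥ ρ L^{-C}`, not BEC). [conjecture: theory seat hubbard-h0-rotor-theory-1, cycle 7, 2026-08-28 — memo ROTOR-THEORY-7 §92 hypothesis (IR_α)] -/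
def InfraredStructureBound (Δ : ℝ) (M : ℕ → ℝ) : Prop :=
  ∃ c > (0 : ℝ), ∃ α < (2 : ℝ), ∀ᶠ L : ℕ in atTop, ∀ [NeZero L],
    ∀ aM : TensorIndex (TorusSite 2 L) 2 → ℝ,
      IsPerronSectorGroundAmplitude L Δ (M L - 1) aM →
        ∀ k : TorusSite 2 L, k ≠ 0 →
          c * (torusNorm L k) ^ α
            ≤ structureFactor L aM ((L : ℝ) ^ 2 / 2 + (M L - 1)) k

/-- Upper structure bound `S_L(k) ≤ S_max` for both sectors (no Bragg peak; implied by the UPPER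
compressibility bound (K) and the f-sum rule via `S ≤ √(m₁ m₋₁)`). [conjecture: theory seat hubbard-h0-rotor-theory-1, cycle 7, 2026-08-28 — memo ROTOR-THEORY-7 §92 hypothesis (S ≤ S_max)] -/
def StructureFactorUpper (Δ : ℝ) (M : ℕ → ℝ) : Prop :=
  ∃ Smax : ℝ, ∀ᶠ L : ℕ in atTop, ∀ [NeZero L],
    ∀ a : TensorIndex (TorusSite 2 L) 2 → ℝ, ∀ M' ∈ ({M L, M L - 1} : Set ℝ),
      IsPerronSectorGroundAmplitude L Δ M' a →
        ∀ k : TorusSite 2 L, k ≠ 0 → structureFactor L a ((L : ℝ) ^ 2 / 2 + M') k ≤ Smax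

/-- **HYPOTHESIS H1 — `OneBodyInsertionStructure` (the analytic heart of the route; OPEN).**
Eventually in `L`, for all Perron pairs and sites `x`, the log insertion ratio decomposes on the support
as `log(ν_x/π̃_x) = c + Σ_s U(s) n_s + R` with (i) the MEAN remainder bounded, `(E_{ν_x} − E_{π̃_x}) R ≤ r`,
and (ii) a kernel of RPA size, `|Û(k)| · S_M(k) · M ≤ C₁ |Λ|` for `k ≠ 0`.  EXACT with `R ≡ const` at the
free-fermion point (`d = 1, Δ = 0`: `U = 2 log|2 sin(π d/L)|`) and at `Δ = 1` (`U ≡ 0`); ED: one-body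
share of `J` ≥ 97 %, kernel/RPA = 0.97 (1D) … 1.1–1.5 (2D) at `k_min` (memo §87a, §91). [conjecture: theory seat hubbard-h0-rotor-theory-1, cycle 7, 2026-08-28 — memo ROTOR-THEORY-7 §93 hypothesis H1 (OPEN)] -/
def OneBodyInsertionStructure (Δ : ℝ) (M : ℕ → ℝ) : Prop :=
  ∃ r C₁ : ℝ, ∀ᶠ L : ℕ in atTop, ∀ [NeZero L],
    ∀ aN aM : TensorIndex (TorusSite 2 L) 2 → ℝ,
      IsPerronSectorGroundAmplitude L Δ (M L) aN → IsPerronSectorGroundAmplitude L Δ (M L - 1) aM →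
        ∀ x : TorusSite 2 L,
          (∀ τ, 0 < holeLaw aN x τ ↔ 0 < vacantLaw aM x τ) ∧
          ∃ (U : TorusSite 2 L → ℝ) (c : ℝ) (R : TensorIndex (TorusSite 2 L) 2 → ℝ),
            (∀ τ, 0 < vacantLaw aM x τ →
              Real.log (holeLaw aN x τ / vacantLaw aM x τ) = c + linStat U τ + R τ) ∧
            (∑ τ, (holeLaw aN x τ - vacantLaw aM x τ) * R τ ≤ r) ∧
            (∀ k : TorusSite 2 L, k ≠ 0 →
              ‖kernelFT L U k‖ * structureFactor L aM ((L : ℝ) ^ 2 / 2 + (M L - 1)) k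
                  * ((L : ℝ) ^ 2 / 2 + (M L - 1)) ≤ C₁ * (L : ℝ) ^ 2)

/-- **REDUCTION (paper-proved, memo §93; Lean proof deferred — needs character orthogonality on
`(ℤ/L)²`):**  `H1 ∧ (IR_α) ∧ (S ≤ S_max) ⇒ E_J`.  Proof on paper: `J_x = Σ_s U δρ_x + (E_ν−E_π̃)R`
(`jDiv_holeLaw_eq_onebody`); Parseval and the identity `δρ̂_x(k) = e^{-ikx}[S_N − 1 + ρ_M S_M/(1−ρ_M)]`
give `|Σ_s U δρ_x| ≤ |Λ|⁻¹ Σ_{k≠0} |Û(k)| (1 + S_max)/(1 − ρ_M) ≤ C₁(1+S_max)/((1−ρ_M) M) · Σ_{k≠0} S_M(k)⁻¹`,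
and (IR_α) with `|Λ|⁻¹ Σ_{k≠0} |k|_T^{-α} ≤ C(α) < ∞` (`α < 2`, `d = 2`) bounds the last sum by
`C(α)|Λ|/c`; so `J_x ≤ r + C₁ C(α)(1+S_max)/(c ρ_M (1−ρ_M))` uniformly.  Recorded as a named claim. [conjecture: theory seat hubbard-h0-rotor-theory-1, cycle 7, 2026-08-28 — memo ROTOR-THEORY-7 §93 reduction, proved on paper (Parseval + character orthogonality), Lean proof deferred] -/
def EntropyRouteReduction : Prop :=
  ∀ (Δ : ℝ) (M : ℕ → ℝ), OneBodyInsertionStructure Δ M → InfraredStructureBound Δ M →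
    StructureFactorUpper Δ M → InsertionJBound Δ M

end Infrared

/-! ## F. THEOREM E-JASTROW: an exactly one-body insertion ratio with an ℓ¹ kernel forces a
condensate floor (unconditional; the finite-range Jastrow class, memo §94) -/

section Jastrow

variable {V : Type} [Fintype V] [DecidableEq V]

/-- A site density under a probability law lies in `[0,1]`. (theory seat `hubbard-h0-rotor-theory-1`, memo ROTOR-THEORY-7) [folklore] -/
theorem sum_mul_occ_mem_unitInterval (p : (V → Fin 2) → ℝ) (s : V) (hp : ∀ τ, 0 ≤ p τ)
    (hp1 : ∑ τ, p τ = 1) : 0 ≤ ∑ τ, p τ * occ τ s ∧ ∑ τ, p τ * occ τ s ≤ 1 := by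
  have hocc : ∀ τ : V → Fin 2, 0 ≤ occ τ s ∧ occ τ s ≤ 1 := by
    intro τ; unfold occ; split_ifs <;> norm_num
  refine ⟨Finset.sum_nonneg fun τ _ => mul_nonneg (hp τ) (hocc τ).1, ?_⟩
  calc ∑ τ, p τ * occ τ s ≤ ∑ τ, p τ :=
        Finset.sum_le_sum fun τ _ => mul_le_of_le_one_right (hp τ) (hocc τ).2
    _ = 1 := hp1

/-- `|δρ_x(s)| ≤ 1`: the insertion response is a difference of two densities. (theory seat `hubbard-h0-rotor-theory-1`, memo ROTOR-THEORY-7) [folklore] -/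
theorem abs_insertionResponse_le_one (aM aN : (V → Fin 2) → ℝ) (x s : V)
    (hρ : 0 < siteDensity aN x) (hM1 : ∑ τ, aM τ ^ 2 = 1) (hq : siteDensity aM x < 1) :
    |insertionResponse aM aN x s| ≤ 1 := by
  have h1 := sum_mul_occ_mem_unitInterval (holeLaw aN x) s (holeLaw_nonneg aN x hρ) (sum_holeLaw aN x hρ)
  have h2 := sum_mul_occ_mem_unitInterval (vacantLaw aM x) s (vacantLaw_nonneg aM x hq)
    (sum_vacantLaw aM x hM1 hq)
  have hsplit : insertionResponse aM aN x s
      = ∑ τ, holeLaw aN x τ * occ τ s - ∑ τ, vacantLaw aM x τ * occ τ s := by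
    unfold insertionResponse
    rw [← Finset.sum_sub_distrib]
    exact Finset.sum_congr rfl fun τ _ => by ring
  rw [hsplit, abs_le]
  constructor <;> linarith [h1.1, h1.2, h2.1, h2.2]

/-- **THEOREM E-JASTROW (BEC criterion, unconditional).**  If for every site `x` the log insertion ratio
is EXACTLY one-body on the support, `log(ν_x/π̃_x) = c_x + Σ_s U_x(s) n_s`, with `Σ_s |U_x(s)| ≤ B`, then
`n₀/|V| ≥ ρ (1 − ρ_M) e^{−B}`.  Covers every `P`-independent finite-range Jastrow family
`ψ_P ∝ Π_{i<j} e^{−u(z_i − z_j)}` (`U_x = −2u(x − ·)`, `B = 2‖u‖_{ℓ¹}`) in ANY dimension — such states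
always condense (their parent stoquastic Hamiltonians are frustration-free in every sector, hence
infinitely compressible: (K) fails there while BEC holds).  Genuine 1D ground states escape through a
NON-summable kernel (`U = 2 log|2 sin(π d/L)|` at the free point, `‖U‖_{ℓ¹} ~ L log L`). (theory seat `hubbard-h0-rotor-theory-1`, memo ROTOR-THEORY-7) [folklore] -/
theorem condensateDensity_ge_of_onebody [Nonempty V] (aM aN : (V → Fin 2) → ℝ) (ρ ρM B : ℝ)
    (hρ : 0 < ρ) (hρM : ρM < 1) (hM : ∀ τ, 0 ≤ aM τ) (hN : ∀ σ, 0 ≤ aN σ) (hM1 : ∑ τ, aM τ ^ 2 = 1)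
    (hdens : ∀ x, siteDensity aN x = ρ) (hdensM : ∀ x, siteDensity aM x = ρM)
    (hac : ∀ x τ, 0 < holeLaw aN x τ ↔ 0 < vacantLaw aM x τ)
    (hJas : ∀ x, ∃ (U : V → ℝ) (c : ℝ), (∑ s, |U s|) ≤ B ∧
      ∀ τ, 0 < vacantLaw aM x τ →
        Real.log (holeLaw aN x τ / vacantLaw aM x τ) = c + linStat U τ) :
    ρ * (1 - ρM) * Real.exp (-B) ≤ condensateDensity aN := by
  have hρx : ∀ x, 0 < siteDensity aN x := fun x => by rw [hdens x]; exact hρ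
  have hqx : ∀ x, siteDensity aM x < 1 := fun x => by rw [hdensM x]; exact hρM
  refine condensateDensity_ge_of_jDiv aM aN ρ ρM B hρ hρM hM hN hM1 hdens hdensM hac fun x => ?_
  obtain ⟨U, c, hB, hF⟩ := hJas x
  have hF' : ∀ τ, 0 < vacantLaw aM x τ →
      Real.log (holeLaw aN x τ / vacantLaw aM x τ) = c + linStat U τ + (fun _ => (0 : ℝ)) τ := by
    intro τ hτ; rw [hF τ hτ]; simp
  rw [jDiv_holeLaw_eq_onebody aM aN x U (fun _ => (0 : ℝ)) c (hρx x) hM1 (hqx x) (hac x) hF']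
  simp only [mul_zero, Finset.sum_const_zero, add_zero]
  calc ∑ s, U s * insertionResponse aM aN x s ≤ ∑ s, |U s| := by
        refine Finset.sum_le_sum fun s _ => ?_
        calc U s * insertionResponse aM aN x s ≤ |U s * insertionResponse aM aN x s| := le_abs_self _
          _ = |U s| * |insertionResponse aM aN x s| := abs_mul _ _
          _ ≤ |U s| := mul_le_of_le_one_right (abs_nonneg _)
              (abs_insertionResponse_le_one aM aN x s (hρx x) hM1 (hqx x))
    _ ≤ B := hB

end Jastrow

end Summit.HubbardSuperconductivity.HubbardSuperconductivity.Theorems.AnisotropyChord.InsertionEntropy
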